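import Summits.QuantumFields.BalabanUV.T4Continuum.Support.NE3DecomposedRepOfShapes
import Summits.QuantumFields.BalabanUV.T4Continuum.Support.NE3LocalSupMajorantWitness
import HarnessLib

/-!
# T⁴ programme, node NE3 — route Π, item 3d «(Π-REG)-NV», BALL FORM: the junction's hypothesis shape
# `NE3DecomposedRepOfShapes.LocalSupMajorantBall` is inhabited — `C = 1` for unimodular fields, `C = √d` for one polarisation

NE3 formalisation swarm `b2b-balaban-t4-ne3-formalise-*`, LEAF PROVER 03 (gen 11); sibling of `Support/NE3LocalSupMajorantWitness.lean`
(the BOX form `NE3LinearNormalPartPreSizes.LocalSupMajorant`, p240565), written for the shape the junction `decomposedRep_of_shapes` (file 4 of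
D-ne3p1-g25-1 §4, p242094) actually consumes: `dom` ranges over the ℓ¹ dependency ball `l1 (y − L^k•z) ≤ depRad d L k` instead of the block
union.  A GLOBAL sup bound does not see the difference, so the principle and the two displayed constants carry over verbatim:
`localSupMajorantBall_of_sup_of_mass` (global sup + ONE mass inequality), `localSupMajorantBall_of_norm_eq` ∕ `_const` ∕ `_signWave`
(**`C = 1`**), `localSupMajorantBall_onePol` (**`C = √d`**), one `example` at d = 4, L = 2.  All [folklore]; 0 sorry; 0 def.

HONEST FRAMING.  A NON-VACUITY witness for OUR hypothesis shape; it says NOTHING about the relative field of a minimiser pair (that is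
[Balaban1985Variational] Thm 1 ∕ Prop 2 regularity TYPE, a typed leaf, asserted for nothing); `DecomposedRep`'s three sizes, (P♮)_W, T-E_w♯ and
NE3 are NOT proved; spine PROVED 0∕9; finite T⁴ rung (B)+1 — NOT infinite volume, NOT mass gap, NOT BetaPertH, NOT Clay.  ABSOLUTE RULE kept
(no printed sentence is a hypothesis).  PLACEMENT: `Summits/QuantumFields/BalabanUV/`.  HONEST DEPENDENCY: continuum YM on T⁴ ⇐ BetaPertH ∧
nine spine estimates (0/9 proved); BetaPertH ⇐ (D1) ∧ (D4) ∧ CAP+tail; G-an2-4 gates asym, D1 and NE2/3/4.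
-/

set_option autoImplicit false

open scoped BigOperators Matrix.Norms.L2Operator
open Finset

namespace Summit.QuantumFields.BalabanUV.T4Continuum.NE3LocalSupMajorantBallWitness

open Literature.MathematicalPhysics.QuantumFieldTheory.Balaban1983to89
open B7Prop1Explicit B7Prop1Local
open T4AveragingDeficitWall (dirSq)
open T4AveragingDeficitWallBoundary (periodBox card_periodBox mem_periodBox)
open NE3DecomposedRepOfShapes (LocalSupMajorantBall)
open NE3LocalSupMajorantWitness (sum_periodBox_const dirSq_of_norm_eq norm_real_smul_of_abs_eq_one norm_onePol dirSq_onePol)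

noncomputable section

variable {d : ℕ} {n : Type*} [Fintype n] [DecidableEq n]

/-! ## The witnesses for the BALL form (the shape the junction consumes) -/

/-- **THE PRINCIPLE, BALL FORM**: a global sup bound is a majorant on every dependency ball, and `sq` is the same mass inequality. [folklore] -/
theorem localSupMajorantBall_of_sup_of_mass {L N k : ℕ} {X₀ : Site d → Fin d → Matrix n n ℂ} {r C : ℝ} (hr : 0 ≤ r)
    (hX : ∀ (x : Site d) (μ : Fin d), ‖X₀ x μ‖ ≤ r) (hC : 0 ≤ C)
    (hmass : ((L : ℝ) ^ k) ^ d * ((N : ℝ) ^ d * ((d : ℝ) * r ^ 2)) ≤ C ^ 2 * dirSq X₀ (periodBox (d := d) (N * L ^ k))) :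
    LocalSupMajorantBall L N k X₀ (fun _ _ => r) C where
  nonneg := fun _ _ => hr
  dom := fun _ _ y μ _ => hX y μ
  hC := hC
  sq := by rw [sum_periodBox_const]; exact hmass

/-- **UNIMODULAR FIELDS, BALL FORM: `C = 1`.** [folklore] -/
theorem localSupMajorantBall_of_norm_eq {L N k : ℕ} {X₀ : Site d → Fin d → Matrix n n ℂ} {r : ℝ} (hr : 0 ≤ r)
    (hX : ∀ (x : Site d) (μ : Fin d), ‖X₀ x μ‖ = r) : LocalSupMajorantBall L N k X₀ (fun _ _ => r) 1 := by
  refine localSupMajorantBall_of_sup_of_mass hr (fun x μ => (hX x μ).le) zero_le_one (le_of_eq ?_)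
  have e1 : dirSq X₀ (periodBox (d := d) (N * L ^ k)) = (((N * L ^ k) ^ d : ℕ) : ℝ) * ((d : ℝ) * r ^ 2) := by
    rw [dirSq_of_norm_eq hX, card_periodBox]
  rw [e1]
  push_cast
  ring

/-- **THE CONSTANT FIELD, BALL FORM**: majorant `‖A‖`, `C = 1`. [folklore] -/
theorem localSupMajorantBall_const (L N k : ℕ) (A : Matrix n n ℂ) :
    LocalSupMajorantBall L N k (fun (_ : Site d) (_ : Fin d) => A) (fun _ _ => ‖A‖) 1 :=
  localSupMajorantBall_of_norm_eq (norm_nonneg A) fun _ _ => rfl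

/-- **SIGN WAVES, BALL FORM**: `|s| = 1` pointwise ⇒ majorant `‖A‖`, `C = 1`. [folklore] -/
theorem localSupMajorantBall_signWave (L N k : ℕ) (s : Site d → Fin d → ℝ) (hs : ∀ (x : Site d) (μ : Fin d), |s x μ| = 1)
    (A : Matrix n n ℂ) :
    LocalSupMajorantBall L N k (fun (x : Site d) (μ : Fin d) => ((s x μ : ℝ) : ℂ) • A) (fun _ _ => ‖A‖) 1 :=
  localSupMajorantBall_of_norm_eq (norm_nonneg A) fun x μ => norm_real_smul_of_abs_eq_one (hs x μ) A

/-- **ONE POLARISATION, BALL FORM: `C = √d`.** [folklore] -/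
theorem localSupMajorantBall_onePol (L N k : ℕ) (μ₀ : Fin d) (A : Matrix n n ℂ) :
    LocalSupMajorantBall L N k (fun (_ : Site d) (μ : Fin d) => if μ = μ₀ then A else (0 : Matrix n n ℂ)) (fun _ _ => ‖A‖)
      (Real.sqrt d) := by
  refine localSupMajorantBall_of_sup_of_mass (norm_nonneg A) (fun _ μ => ?_) (Real.sqrt_nonneg _) (le_of_eq ?_)
  · rw [norm_onePol μ₀ A μ]; split_ifs
    · exact le_rfl
    · exact norm_nonneg A
  · have e1 : dirSq (fun (_ : Site d) (μ : Fin d) => if μ = μ₀ then A else (0 : Matrix n n ℂ)) (periodBox (d := d) (N * L ^ k))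
        = (((N * L ^ k) ^ d : ℕ) : ℝ) * ‖A‖ ^ 2 := by rw [dirSq_onePol, card_periodBox]
    rw [e1, Real.sq_sqrt (Nat.cast_nonneg d)]
    push_cast
    ring

/-- At d = 4, L = 2, N = 1, k = 1, `n = Fin 2`: the constant field carries the BALL form with `C = 1` (the junction's (Π-REG) slot is inhabited). -/
example (A : Matrix (Fin 2) (Fin 2) ℂ) :
    LocalSupMajorantBall (d := 4) 2 1 1 (fun (_ : Site 4) (_ : Fin 4) => A) (fun _ _ => ‖A‖) 1 :=
  localSupMajorantBall_const 2 1 1 A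

end

end Summit.QuantumFields.BalabanUV.T4Continuum.NE3LocalSupMajorantBallWitness
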